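import Mathlib
import Summits.PneNP.PneNP.Theorems.Nc03AvoidResidualCoreReductionMajB

/-!
# Route Nc03AvoidResidualCore, item `ResidualCoreReduction` — the `MAJ₃` class: certificates exist

Helper file for `stmt-PneNP-20227` (sequel of `…ReductionMajB`, `…ReductionFlip`; cell pnp-ideate).
The junction multigraph `G6 I` of a pure `MAJ₃` instance has the `2N` vertices "variable `v` in
role `0`" (`2v`, side A) and "variable `v` in role `1`" (`2v+1`, side B), and one edge per output.
Balance on it is exactly the hypothesis of `maj_rigid`. With `P6 I` the greedy packing of all
outputs (even degrees, `|P6| ≥ M - 2N`) and `U` the space of vectors "constant on label classes of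
`P6`" (dimension `≤ N`), the one-flip lemma yields, whenever `5N < M`, a non-forest edge `e` of `P6`
and a bit `b` such that the candidate pattern `flipCol P6 e b` — balanced and supported on `P6` —
is NOT constant on some label class, i.e. is bichromatic; by rigidity it lies outside the range
(`cert6_sound`, `cert6_exists`). The search over `(e, b)` with the bichromatic test is what the
polynomial-time solver runs. [folklore]
-/

set_option linter.dupNamespace false -- `Summit.PneNP.PneNP.…`: summit = sub-problem name (D-0017 single-conjunct layout)

namespace Summit.PneNP.PneNP.Theorems.Nc03Reduction

open Finset Literature.Computability.Complexity

variable {N M : ℕ}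

/-- The junction multigraph of an instance: edge `j` joins "its role-`0` variable, as an A-vertex
`2v`" to "its role-`1` variable, as a B-vertex `2v+1`". -/
def G6 (I : LocalMap 3 N M) : Bip (Fin M) (Fin (2 * N)) where
  eA j := ⟨2 * (I.vars j 0).val, by have := (I.vars j 0).isLt; omega⟩
  eB j := ⟨2 * (I.vars j 1).val + 1, by have := (I.vars j 1).isLt; omega⟩
  side w := decide (w.val % 2 = 1)
  sideA j := by simp
  sideB j := by simp

/-- A-endpoints of the junction multigraph encode role-`0` variables. -/
theorem G6_eA_eq_iff (I : LocalMap 3 N M) (j : Fin M) (v : Fin N) :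
    (G6 I).eA j = ⟨2 * v.val, by have := v.isLt; omega⟩ ↔ I.vars j 0 = v := by
  simp only [G6, Fin.ext_iff]
  omega

/-- B-endpoints of the junction multigraph encode role-`1` variables. -/
theorem G6_eB_eq_iff (I : LocalMap 3 N M) (j : Fin M) (v : Fin N) :
    (G6 I).eB j = ⟨2 * v.val + 1, by have := v.isLt; omega⟩ ↔ I.vars j 1 = v := by
  simp only [G6, Fin.ext_iff]
  omega

/-- Balance on the junction multigraph is balance at the two junction roles. -/
theorem bal6 (I : LocalMap 3 N M) {P : Finset (Fin M)} {y : Fin M → Bool} (h : (G6 I).Bal P y) :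
    (∀ v, (P.filter fun j => I.vars j 0 = v ∧ y j = true).card =
      (P.filter fun j => I.vars j 0 = v ∧ y j = false).card) ∧
    (∀ v, (P.filter fun j => I.vars j 1 = v ∧ y j = true).card =
      (P.filter fun j => I.vars j 1 = v ∧ y j = false).card) := by
  classical
  refine ⟨fun v => ?_, fun v => ?_⟩
  · have h1 := h.1 ⟨2 * v.val, by have := v.isLt; omega⟩
    have e : ∀ c : Bool, (P.filter fun j => (G6 I).eA j = ⟨2 * v.val, by have := v.isLt; omega⟩ ∧ y j = c) =
        P.filter fun j => I.vars j 0 = v ∧ y j = c := by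
      intro c; ext j; simp only [Finset.mem_filter, G6_eA_eq_iff]
    rw [e, e] at h1
    convert h1 using 2
  · have h1 := h.2 ⟨2 * v.val + 1, by have := v.isLt; omega⟩
    have e : ∀ c : Bool, (P.filter fun j => (G6 I).eB j = ⟨2 * v.val + 1, by have := v.isLt; omega⟩ ∧ y j = c) =
        P.filter fun j => I.vars j 1 = v ∧ y j = c := by
      intro c; ext j; simp only [Finset.mem_filter, G6_eB_eq_iff]
    rw [e, e] at h1
    convert h1 using 2

/-- A pattern is bichromatic on `P`: some label variable occurs in `P` on outputs of both colours. -/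
def Bichrom (I : LocalMap 3 N M) (P : Finset (Fin M)) (y : Fin M → Bool) : Prop :=
  ∃ j₁ ∈ P, ∃ j₂ ∈ P, I.vars j₁ 2 = I.vars j₂ 2 ∧ y j₁ = true ∧ y j₂ = false

/-- The label map: vectors constant on the label classes of `P` form its range. -/
noncomputable def labelMap (I : LocalMap 3 N M) (P : Finset (Fin M)) :
    (Fin N → ZMod 2) →ₗ[ZMod 2] (Fin M → ZMod 2) where
  toFun g := fun j => if j ∈ P then g (I.vars j 2) else 0
  map_add' g g' := by funext j; simp only [Pi.add_apply]; split_ifs <;> simp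
  map_smul' r g := by funext j; simp only [Pi.smul_apply, smul_eq_mul, RingHom.id_apply]; split_ifs <;> simp

/-- A pattern supported in `P` that is NOT bichromatic is constant on label classes: its indicator
lies in the range of the label map. -/
theorem chiP_mem_range_of_not_bichrom (I : LocalMap 3 N M) (P : Finset (Fin M)) {y : Fin M → Bool}
    (hsupp : ∀ j, y j = true → j ∈ P) (hno : ¬ Bichrom I P y) :
    chiP y ∈ LinearMap.range (labelMap I P) := by
  classical
  refine ⟨fun c => if ∃ j ∈ P, I.vars j 2 = c ∧ y j = true then 1 else 0, ?_⟩
  funext j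
  simp only [labelMap, LinearMap.coe_mk, AddHom.coe_mk, chiP_apply]
  by_cases hjP : j ∈ P
  · rw [if_pos hjP]
    cases hyj : y j
    · rw [if_neg, if_neg (by simp)]
      rintro ⟨j', hj'P, hlab, hyj'⟩
      exact hno ⟨j', hj'P, j, hjP, hlab, hyj', hyj⟩
    · rw [if_pos ⟨j, hjP, rfl, hyj⟩, if_pos rfl]
  · rw [if_neg hjP]
    cases hyj : y j
    · simp
    · exact absurd (hsupp j hyj) hjP

section NeZero

variable [NeZero M]

/-- The packed (even-degree) part of the junction multigraph of all outputs. -/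
noncomputable def P6 (I : LocalMap 3 N M) : Finset (Fin M) := (G6 I).packUnion Finset.univ

/-- The packed part has even degrees at A-vertices. -/
theorem P6_evenA (I : LocalMap 3 N M) (a : Fin (2 * N)) :
    Even ((P6 I).filter fun j => (G6 I).eA j = a).card :=
  Bip.Bal.even_degA (G6 I) ((G6 I).bal_packUnion Finset.univ) a

/-- The packed part has even degrees at B-vertices. -/
theorem P6_evenB (I : LocalMap 3 N M) (b : Fin (2 * N)) :
    Even ((P6 I).filter fun j => (G6 I).eB j = b).card :=
  Bip.Bal.even_degB (G6 I) ((G6 I).bal_packUnion Finset.univ) b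

/-- The packed part misses at most `2N` outputs. -/
theorem card_P6 (I : LocalMap 3 N M) : M ≤ (P6 I).card + 2 * N := by
  have h := (G6 I).card_le_packUnion Finset.univ
  rw [Finset.card_univ, Fintype.card_fin, Fintype.card_fin] at h
  exact h

/-- **Soundness of the `MAJ₃` certificate**: a bichromatic candidate pattern of the packed part is
outside the range. -/
theorem cert6_sound {I : LocalMap 3 N M} (hP : I.IsPure (rep 6)) {e : Fin M} (heP : e ∈ P6 I)
    (heT : e ∉ (G6 I).forest (P6 I)) (b : Bool)
    (hbi : Bichrom I (P6 I) ((G6 I).flipCol (P6 I) e b)) :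
    (G6 I).flipCol (P6 I) e b ∉ I.range := by
  have hbal := (G6 I).bal_flipCol (P6 I) (P6_evenA I) (P6_evenB I) heP heT b
  obtain ⟨h0, h1⟩ := bal6 I hbal
  obtain ⟨j₁, hj₁, j₂, hj₂, hlab, hy₁, hy₂⟩ := hbi
  exact maj_rigid hP (P6 I) h0 h1 hj₁ hj₂ hlab hy₁ hy₂

/-- **Existence of the `MAJ₃` certificate at linear stretch**: if `5N < M`, some non-forest edge
of the packed part and some bit give a bichromatic candidate pattern. -/
theorem cert6_exists (I : LocalMap 3 N M) (hM : 5 * N < M) :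
    ∃ e ∈ P6 I, e ∉ (G6 I).forest (P6 I) ∧ ∃ b : Bool, Bichrom I (P6 I) ((G6 I).flipCol (P6 I) e b) := by
  set U := LinearMap.range (labelMap I (P6 I)) with hU
  have hdim : Module.finrank (ZMod 2) U ≤ N := by
    have h := LinearMap.finrank_range_le (labelMap I (P6 I))
    rw [Module.finrank_fintype_fun_eq_card, Fintype.card_fin] at h
    exact h
  have hcard := card_P6 I
  have hhyp : Module.finrank (ZMod 2) U + Fintype.card (Fin (2 * N)) < (P6 I).card := by
    rw [Fintype.card_fin]; omega
  obtain ⟨e, heP, heT, b, hb⟩ := (G6 I).exists_flipCol_not_mem (P6 I) U hhyp 0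
  refine ⟨e, heP, heT, b, ?_⟩
  by_contra hno
  apply hb
  rw [zero_add]
  exact chiP_mem_range_of_not_bichrom I (P6 I) (fun j hj => (G6 I).mem_of_flipCol heP hj) hno

/-- **`MAJ₃` at linear stretch**: a pure `MAJ₃` instance with `5N < M` misses a pattern. -/
theorem exists_not_mem_range_maj {I : LocalMap 3 N M} (hP : I.IsPure (rep 6)) (hM : 5 * N < M) :
    ∃ y, y ∉ I.range := by
  obtain ⟨e, heP, heT, b, hb⟩ := cert6_exists I hM
  exact ⟨_, cert6_sound hP heP heT b hb⟩

end NeZero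

end Summit.PneNP.PneNP.Theorems.Nc03Reduction
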